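import Summits.QuantumFields.YangMills.Theorems.UnitScaleTiltProp7ConjFrameTransport
import HarnessLib

/-!
# Route `UnitScaleTilt`, crux K1 «MinimiserStabilityRegPr» (stmt-QuantumFields-19200), route-R E′ path (α′), row LEMMA-H-CURVED — FILE 3β:
# THE FRAMED CORNER BLEND `Φ(x) = Σ_y W_y(x)·R(P_y(x)) m(y)` — its covariant Laplacian, term by term, and the MASTER POINTWISE BOUND
# `‖Δ_UΦ(x)‖ ≤ Σ_y|W_y(x)|·‖Δ_U(R(P_y)m_y)(x)‖ + Σ_μΣ_y(|∂⁻_μW_y|·‖D*_μ(R(P_y)m_y)‖ + |∂⁺_μW_y|·‖D_μ(R(P_y)m_y)‖)(x) + Σ_μΣ_y|Δ²_μW_y(x)|·‖R(P_y(x))m_y − Z_μ(x)‖`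
# (any recentring `Z`, by the partition of unity) — the design of record (x2′-corner), frames and weights abstract

Cell `ym3-torus`, D-0154 (3c) twin-width seat `ym-routeR-w1` (gen 5); row "routeR-w1 g5: LEMMA-H-CURVED" (namer ★ym-ust-19200-p1 g14, 2026-08-28 17:33Z; design of record
(x2′-corner), bus 18:49Z).  THEOREMS ONLY (0 `def`, 0 `sorry`); `--supports stmt-QuantumFields-19200`, count-neutral.  YM₃ on T³ is a ladder rung (R3), not the Clay problem;
nothing here claims a stub, the crux, d = 4 or the mass gap.

WHY.  LEMMA-H-curved ⟸ F-H1 (✓ `Prop7CentreBiharmonicDirichlet.lap_energy_le_of_extension_T3`) + ONE extension of the centre data with small covariant Laplacian energy.  The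
extension of record is the CORNER BLEND: the C¹ cardinal weights `W_y` of ✓ `Prop7HermiteCardinalWeights` (F-H3α: partition of unity, `|Δ²W| ≤ 12∕ℓ²`, `|∇W| ≤ 3∕ℓ`,
interpolation) times the corner value `m(y)` carried to `x` by a FRAME `P_y(x)` (one (3.35)-type cube gauge per centre, [Balaban1985BackgroundPropagators] (3.35); abstract
here).  THIS FILE is the frame-and-weight-agnostic ALGEBRA on ✓ `Prop7ConjFrameTransport`'s carrier (★routeR-w4 g9: `S`, `ι`, `T`, `U`, ring `𝔸`): (§1) the covariant
derivatives and `Δ_U = divB ∘ covD` are additive over the finite sum in `y`; (§2) the Leibniz rows (✓ `divB_covD_smul_fun`) split `Δ_UΦ` into weights × `Δ_U` of framed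
constants, weight gradients × covariant derivatives of framed constants, and weight second differences × framed constants; (§3) since `Σ_y W_y ≡ 1` the weight second
differences sum to zero, so the last group may be RECENTRED at any `Z_μ(x)` (the consumer takes `Z` = the framed value of a reference corner, turning it into coarse covariant
differences + frame mismatches, ✓ `Prop7ConjFrameTransition`); (§4) the MASTER pointwise norm bound.  The three groups are then sized by F-H3α's weight rows and
★routeR-w4's frame rows (`norm_covD_conjFrame_le`, `norm_covDstar_covD_conjFrame_le_pair`, `norm_frame_mismatch_le`) — the next file, with the (3.35) hypothesis displayed.

WHAT IS PROVED (ns `…Theorems.Prop7HermiteCornerBlendCov`).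
* §1 `covD_finset_sum`, `covDstar_finset_sum`, `divB_covD_finset_sum` (additivity over `Σ_y`).
* §2 ★★ `lap_cornerBlend_eq` — `Δ_U(Σ_y W_y·R(P_y)m_y)(x)` = the three groups, EXACT.
* §3 `sum_secondDiff_weight_eq_zero` (`Σ_yW_y ≡ 1 ⇒ Σ_y Δ²_μW_y(x) = 0`), ★ `sum_secondDiff_smul_recenter` (`Σ_y Δ²_μW_y·X_y = Σ_y Δ²_μW_y·(X_y − Z)`).
* §4 ★★★ `norm_lap_cornerBlend_le` — the master bound of the title (`𝔸` a normed `ℝ`-algebra).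
HONEST SCOPE.  Pure algebra and triangle inequalities; no weight row, no frame row, no background hypothesis is used or asserted here.

References: T. Bałaban, CMP 99 (1985) 389–434 [Balaban1985BackgroundPropagators] ((3.3)–(3.4) pp.390–391, (3.8) p.392, (3.35) p.396); CMP 95 (1984) 17–40
[Balaban1984PropagatorsI] ((1.18) p.20).
-/

set_option autoImplicit false

noncomputable section

open scoped BigOperators

namespace Summit.QuantumFields.YangMills.Theorems.Prop7HermiteCornerBlendCov

open Literature.MathematicalPhysics.QuantumFieldTheory.Balaban1983to89
open B9Eq39Adjoint (R R_def R_add R_sub R_smul covD covDstar divB covD_add covDstar_add)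
open Summit.QuantumFields.YangMills.Theorems.Prop7ConjFrameTransport (divB_covD_smul_fun covDstar_covD_smul_fun)

/-! ## §1 Additivity over the corners -/

section Additive

variable {𝔸 : Type*} [Ring 𝔸] {S : Type*} {ι : Type*} (T : ι → Equiv.Perm S) (U : ι → S → 𝔸ˣ) {Y : Type*}

/-- `D_μ(Σ_y F_y) = Σ_y D_μF_y`. [cite: Balaban1985BackgroundPropagators, (3.3) p.390] -/
theorem covD_finset_sum (s : Finset Y) (F : Y → S → 𝔸) (μ : ι) (x : S) :
    covD T U μ (fun z => ∑ y ∈ s, F y z) x = ∑ y ∈ s, covD T U μ (F y) x := by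
  classical
  induction s using Finset.induction_on with
  | empty => simp [covD, R_def]
  | insert a s ha ih =>
    rw [Finset.sum_insert ha, ← ih, ← covD_add]
    congr 1
    funext z
    rw [Finset.sum_insert ha]
    rfl

/-- `D*_μ(Σ_y G_y) = Σ_y D*_μG_y`. [cite: Balaban1985BackgroundPropagators, (3.8) p.392] -/
theorem covDstar_finset_sum (s : Finset Y) (G : Y → S → 𝔸) (μ : ι) (x : S) :
    covDstar T U μ (fun z => ∑ y ∈ s, G y z) x = ∑ y ∈ s, covDstar T U μ (G y) x := by
  classical
  induction s using Finset.induction_on with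
  | empty => simp [covDstar, R_def]
  | insert a s ha ih =>
    rw [Finset.sum_insert ha, ← ih, ← covDstar_add]
    congr 1
    funext z
    rw [Finset.sum_insert ha]
    rfl

variable [Fintype ι]

/-- `Δ_U(Σ_y F_y) = Σ_y Δ_UF_y` (`Δ_U = divB ∘ covD`). [cite: Balaban1985BackgroundPropagators, (3.8) p.392] -/
theorem divB_covD_finset_sum (s : Finset Y) (F : Y → S → 𝔸) (x : S) :
    divB T U (fun μ => covD T U μ (fun z => ∑ y ∈ s, F y z)) x = ∑ y ∈ s, divB T U (fun μ => covD T U μ (F y)) x := by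
  simp only [divB]
  rw [Finset.sum_comm]
  refine Finset.sum_congr rfl fun μ _ => ?_
  have h1 : (fun z => covD T U μ (fun z => ∑ y ∈ s, F y z) z) = fun z => ∑ y ∈ s, covD T U μ (F y) z := by
    funext z; exact covD_finset_sum T U s F μ z
  show covDstar T U μ (fun z => covD T U μ (fun z => ∑ y ∈ s, F y z) z) x = _
  rw [h1, covDstar_finset_sum]

end Additive

/-! ## §2 The covariant Laplacian of the framed corner blend, term by term -/

section Leibniz

variable {𝔸 : Type*} [Ring 𝔸] [Algebra ℝ 𝔸] {S : Type*} {ι : Type*} [Fintype ι] (T : ι → Equiv.Perm S) (U : ι → S → 𝔸ˣ)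
  {Y : Type*} [Fintype Y]

/-- ★★ **THE COVARIANT LAPLACIAN OF THE FRAMED CORNER BLEND**: for weights `W : Y → S → ℝ`, frames `P : Y → S → 𝔸ˣ`, data `m : Y → 𝔸` and `Φ = Σ_y W_y·R(P_y)m_y`,
`Δ_UΦ(x) = Σ_y W_y(x)·Δ_U(R(P_y)m_y)(x) + Σ_y Σ_μ[(∂⁻_μW_y)(x)·D*_μ(R(P_y)m_y)(x) − (∂⁺_μW_y)(x)·D_μ(R(P_y)m_y)(x)] − Σ_y Σ_μ (Δ²_μW_y)(x)·R(P_y(x))m_y`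
(`∂⁺_μw(x) = w(x+e_μ) − w(x)`, `∂⁻_μw(x) = w(x) − w(x−e_μ)`, `Δ²_μ = ∂⁺_μ − ∂⁻_μ`). [cite: Balaban1985BackgroundPropagators, (3.3)-(3.4) pp.390-391, (3.8) p.392] -/
theorem lap_cornerBlend_eq (W : Y → S → ℝ) (P : Y → S → 𝔸ˣ) (m : Y → 𝔸) (x : S) :
    divB T U (fun μ => covD T U μ (fun z => ∑ y, W y z • R (P y z) (m y))) x
      = ∑ y, W y x • divB T U (fun μ => covD T U μ (fun z => R (P y z) (m y))) x
        + ∑ y, ∑ μ, ((W y x - W y ((T μ).symm x)) • covDstar T U μ (fun z => R (P y z) (m y)) x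
            - (W y (T μ x) - W y x) • covD T U μ (fun z => R (P y z) (m y)) x)
        - ∑ y, ∑ μ, ((W y (T μ x) - W y x) - (W y x - W y ((T μ).symm x))) • R (P y x) (m y) := by
  rw [divB_covD_finset_sum T U Finset.univ (fun y z => W y z • R (P y z) (m y)) x,
    Finset.sum_congr rfl (fun y _ => divB_covD_smul_fun T U (W y) (fun z => R (P y z) (m y)) x),
    ← Finset.sum_add_distrib, ← Finset.sum_sub_distrib]
  refine Finset.sum_congr rfl fun y _ => ?_
  rw [Finset.sum_sub_distrib (f := fun μ => (W y x - W y ((T μ).symm x)) • covDstar T U μ (fun z => R (P y z) (m y)) x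
      - (W y (T μ x) - W y x) • covD T U μ (fun z => R (P y z) (m y)) x)]
  abel

end Leibniz

/-! ## §3 Recentring the main group by the partition of unity -/

section Recenter

variable {𝔸 : Type*} [Ring 𝔸] [Algebra ℝ 𝔸] {S : Type*} {Y : Type*} [Fintype Y]

/-- weights summing to one have second differences summing to zero: `Σ_y W_y ≡ 1 ⇒ Σ_y ((W_y(a) − W_y(x)) − (W_y(x) − W_y(b))) = 0`. [folklore] -/
theorem sum_secondDiff_weight_eq_zero (W : Y → S → ℝ) (hW : ∀ z : S, ∑ y, W y z = 1) (x a b : S) :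
    ∑ y, ((W y a - W y x) - (W y x - W y b)) = 0 := by
  simp only [Finset.sum_sub_distrib, hW]
  ring

/-- ★ **RECENTRING**: `Σ_y δ_y·X_y = Σ_y δ_y·(X_y − Z)` whenever `Σ_y δ_y = 0`. [folklore] -/
theorem sum_secondDiff_smul_recenter (δ : Y → ℝ) (hδ : ∑ y, δ y = 0) (X : Y → 𝔸) (Z : 𝔸) :
    ∑ y, δ y • X y = ∑ y, δ y • (X y - Z) := by
  simp only [smul_sub, Finset.sum_sub_distrib, ← Finset.sum_smul, hδ, zero_smul, sub_zero]

end Recenter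

/-! ## §4 The master pointwise bound -/

section Master

variable {𝔸 : Type*} [NormedRing 𝔸] [NormedAlgebra ℝ 𝔸] {S : Type*} {ι : Type*} [Fintype ι] (T : ι → Equiv.Perm S) (U : ι → S → 𝔸ˣ)
  {Y : Type*} [Fintype Y]

/-- ★★★ **MASTER POINTWISE BOUND FOR THE FRAMED CORNER BLEND** (partition of unity `Σ_yW_y ≡ 1`, any recentring `Z_μ(x)`):
`‖Δ_UΦ(x)‖ ≤ Σ_y|W_y(x)|·‖Δ_U(R(P_y)m_y)(x)‖ + Σ_yΣ_μ(|∂⁻_μW_y(x)|·‖D*_μ(R(P_y)m_y)(x)‖ + |∂⁺_μW_y(x)|·‖D_μ(R(P_y)m_y)(x)‖) + Σ_μΣ_y|Δ²_μW_y(x)|·‖R(P_y(x))m_y − Z_μ‖`.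
[cite: Balaban1985BackgroundPropagators, (3.3)-(3.4) pp.390-391, (3.8) p.392, (3.35) p.396] -/
theorem norm_lap_cornerBlend_le (W : Y → S → ℝ) (hW : ∀ z : S, ∑ y, W y z = 1) (P : Y → S → 𝔸ˣ) (m : Y → 𝔸) (x : S) (Z : ι → 𝔸) :
    ‖divB T U (fun μ => covD T U μ (fun z => ∑ y, W y z • R (P y z) (m y))) x‖
      ≤ ∑ y, |W y x| * ‖divB T U (fun μ => covD T U μ (fun z => R (P y z) (m y))) x‖
        + ∑ y, ∑ μ, (|W y x - W y ((T μ).symm x)| * ‖covDstar T U μ (fun z => R (P y z) (m y)) x‖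
            + |W y (T μ x) - W y x| * ‖covD T U μ (fun z => R (P y z) (m y)) x‖)
        + ∑ μ, ∑ y, |(W y (T μ x) - W y x) - (W y x - W y ((T μ).symm x))| * ‖R (P y x) (m y) - Z μ‖ := by
  rw [lap_cornerBlend_eq T U W P m x]
  -- recentre the main group direction by direction
  have hmain : ∑ y, ∑ μ, ((W y (T μ x) - W y x) - (W y x - W y ((T μ).symm x))) • R (P y x) (m y)
      = ∑ μ, ∑ y, ((W y (T μ x) - W y x) - (W y x - W y ((T μ).symm x))) • (R (P y x) (m y) - Z μ) := by
    rw [Finset.sum_comm]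
    refine Finset.sum_congr rfl fun μ _ => ?_
    exact sum_secondDiff_smul_recenter _ (sum_secondDiff_weight_eq_zero W hW x (T μ x) ((T μ).symm x)) _ (Z μ)
  rw [hmain]
  refine (norm_sub_le _ _).trans (add_le_add ((norm_add_le _ _).trans (add_le_add ?_ ?_)) ?_)
  · refine (norm_sum_le _ _).trans (Finset.sum_le_sum fun y _ => ?_)
    rw [norm_smul, Real.norm_eq_abs]
  · refine (norm_sum_le _ _).trans (Finset.sum_le_sum fun y _ => (norm_sum_le _ _).trans (Finset.sum_le_sum fun μ _ => ?_))
    refine (norm_sub_le _ _).trans (add_le_add ?_ ?_)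
    · rw [norm_smul, Real.norm_eq_abs]
    · rw [norm_smul, Real.norm_eq_abs]
  · refine (norm_sum_le _ _).trans (Finset.sum_le_sum fun μ _ => (norm_sum_le _ _).trans (Finset.sum_le_sum fun y _ => ?_))
    rw [norm_smul, Real.norm_eq_abs]

end Master

end Summit.QuantumFields.YangMills.Theorems.Prop7HermiteCornerBlendCov

end
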